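import Summits.CriticalPhenomena.Ising3DConformalLimit.Theses.EnergyNotSigmaSquared
import Summits.CriticalPhenomena.Ising3DConformalLimit.Theorems.GapForcesFarMerging.Negative.SoftShapes
import Literature.Probability.LatticeModels.MessagerMiracleSole
import Literature.Probability.LatticeModels.CriticalTwoPointBounds
import HarnessLib.Audit

/-!
# Line `rp-schwarz-single-pinch` — crux `EnergyNotSigmaSquared.GapForcesFarMerging` (stmt-CriticalPhenomena-4468)

Skeleton (crux-plan, round 1; idea card `rp-schwarz-single-pinch` = merge class M1 of the triage
panel TRIAGE-r1-{1,2,3} (pass ×3): "RP Cauchy–Schwarz single-pinch on regular scales", same lever as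
`Ideas/rp-unpinch-single-passage.md` and `Ideas/rp-gram-halving.md`).

CRUX (by name): `GapForcesFarMerging := EnergyGapPowerLaw → FarMerging`
(`Negative.SoftShapes.crux_iff`, `Iff.rfl`).

THE LINE.  Reflection positivity of the critical state across the lattice mirror
`θ_t = axisRefl 0 t : y ↦ (t - y₀, y₁, y₂)` makes the truncated Gram matrix of half-space pair
observables positive semidefinite; its `2 × 2` minor with the ENERGY row `ε_b = σ₀σ_{e₂}`
(`b = {0,e₂}`, the bond of GAP) and a pair row `σ_pσ_q` reads
`⟨ε_b ; σ_{θp}σ_{θq}⟩² ≤ ⟨ε_b ; ε_{θb}⟩ · ⟨σ_pσ_q ; σ_{θp}σ_{θq}⟩` (stub A).  Since `θb = b + t e₀` is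
the PARALLEL translate of `b`, the first factor is exactly the GAP quantity at `x = t e₀`, and the
second is `≤ 2 G(t e₀)²` (Lebowitz `U₄ ≤ 0` + Messager–Miracle-Solé, both in tree in infinite
volume): GAP(κ) ⇒ the ONE-PINCH law `⟨ε_b ; σ_{te₀+p}σ_{te₀+q}⟩ ≤ C t^{-κ/2} G(te₀)²` for all
in-plane `p, q` and ALL `t ≥ 1` (stub B) — the far pinch of GAP is removed by a theorem, with the
sharp exponent `κ/2 = Δ_ε − 2Δ_σ`.  On doubling-REGULAR dyadic scales `t = 2^k`
(`G(4t e₀) ≥ c₀ G(t e₀)`, unboundedly many by `c‖x‖⁻² ≤ G ≤ 1`) the MMS cone comparison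
`G(‖y‖₁ e₀) ≤ G(y) ≤ G(‖y‖_∞ e₀)` converts the bound into its avoidance-ready (cross-Wick /
Aizenman) normalisation `⟨ε_b ; σ_Yσ_Z⟩ ≤ C t^{-κ'} (G(0,Y)G(e₂,Z) + G(0,Z)G(e₂,Y))`, i.e. both
single-pinch avoidance probabilities `P^{0Y}⊗P^{e₂Z}[0 ↮ e₂] ≤ C' t^{-κ'}` (stub R; this is
where "on regular scales" of the card enters, and the only place).  The residual TRANSFER
(stub T, the card's `C⁺`, hardest): a one-pinch power law on unboundedly many regular dyadic
scales forces FAR MERGING along dyadic dilations of one of finitely many THIN split-pinch shapes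
`X_m = (0, 2^m e₀ − 2^m e₂ ; e₂, 2^m e₀ + 2^m e₂)` (sources `0`, `e₂` dilated to distance
`L = 2^j`, targets at distance `2^m L`, labelled so that the `(x₀x₁)(x₂x₃)` pairing product of
`FarMerging` is Aizenman's normalisation of `P^{0,LY}⊗P^{Le₂,LZ}[0 ↔ Le₂]`).  The composition
`GapForcesFarMerging_of : A → B → R → T → GapForcesFarMerging` is PROVED below (GAP fed to B,
chain, then an infinite pigeonhole over the finite shape menu `m ≤ M` and `thinShape_injective`).

DISPROOF USED (`Cruxes/GapForcesFarMerging/Disproof.lean`, gen 2, + landed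
`Theorems/GapForcesFarMerging/Negative/SoftShapes|SoftKernel`):
* `gapForcesFarMerging_false_without_model` (any proof must use structure OUTSIDE the 22-field
  soft package): honoured twice — stub A is reflection positivity (not a package field; §5 of the
  Disproof: "RP IS a coupling between quadruples of different shape"), stub T is the random-current
  coupling across scales.
* `oneEndedGapForcesFarMerging_false_without_model` (§5: the un-pinched residual is not soft either —
  family A has the one-ended gap for ALL far target pairs and no far merging): stub T's hypothesis
  `OnePinchLawOnRegularScales` is WEAKER than `OneEndedGapShape` (mirror pairs, regular scales
  only), so T cannot be argued from inequalities + two-point asymptotics; its proof must run through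
  the sourced-current representation (EnergyFactorisation, item 4472, in infinite volume; hazard
  telescoping at the remaining pinch; EndpointLocality = Disproof §7 (H); Aizenman's identity back).
  Recorded in the line card as T's internal plan; T is the named open step, not hidden.
* gen-1 `cruxWithoutKappaPos_iff` (0 < κ load-bearing): B transports `κ ↦ κ/2 > 0`; R and T carry
  `0 < κ'` explicitly (with `κ' = 0` the one-pinch law is Lebowitz + MMS and T would restate
  FarMerging — the triage's costume warning for `SinglePinchLaw` is answered by the `0 < κ` fields).
* gen-1 `gapHyp_unsat_without_ne_zero`: B applies GAP only at `x = t e₀`, `t ≥ 1`.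
* gen-1 §7 `io_ge_of_prod_le_two_pow` / `io_ge_needs_lt_one` / `density_of_prod_le_two_pow`: T needs
  good scales only INFINITELY OFTEN (its conclusion and `FarMerging` are i.o. statements; R delivers
  regular scales i.o.), never a density — no `m_k ≤ 1 − δ` input is assumed anywhere.
* gen-1 §5 `U4_criticalCorr_eq`, `farMergingFor_criticalCorr_iff_merge`, `farMerging_const_le_two`:
  the dictionary behind the labelling of `thinShape` (pairing `(x₀x₁)(x₂x₃)` = source–target
  products) and the bound `c ≤ 2` T's constant must respect.
No landed Negative lemma refutes an instance of A, B, R or T (SoftShapes/SoftKernel carry shapes,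
the package and the explicit kernel only; imported here and used: `FarMergingShape`, `crux_iff`).

Namespace `…Cruxes.GapForcesFarMerging.RPSchwarzSinglePinch`.  The statement of each stub is a plain
`def … : Prop` (`RPSchwarzOnePinch`, `GapGivesOnePinchLaw`, `RegularReading`, `OnePinchForcesSplitMerging`,
with the intermediate statements `OnePinchLaw`, `OnePinchLawOnRegularScales`, `DyadicSplitMerging`); the
REGISTERED stubs are the sorried `theorem stub_…` (A = `RPSchwarzOnePinch` by name; B, R, T = the
implications unfolded one level); the name-keyed aliases `Registered.stub_…` (abbrevs of the four defs)
are the hypotheses of `GapForcesFarMerging_of`, so that the skeleton audit reads them as the registered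
stubs (the H21.Audit `stub` attribute itself is gate-reserved and is not written by seats).
-/

noncomputable section

namespace Summit.CriticalPhenomena.Ising3DConformalLimit.Cruxes.GapForcesFarMerging.RPSchwarzSinglePinch

open Literature.Probability.LatticeModels
open Summit.CriticalPhenomena.Ising3DConformalLimit.Theses.EnergyNotSigmaSquared
open Summit.CriticalPhenomena.Ising3DConformalLimit.Theorems.GapForcesFarMerging

/-! ## Lattice vocabulary (tree declarations only) -/

/-- `e₀ = (1,0,0)`, the mirror axis. -/
abbrev e₀ : Site 3 := Pi.single 0 1

/-- `e₂ = (0,1,0)`, the direction of the energy bond `b = {0, e₂}` of GAP (the route's `Pi.single 1 1`). -/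
abbrev e₂ : Site 3 := Pi.single 1 1

/-- The dyadic axis point `2^k e₀`. -/
abbrev dy (k : ℕ) : Site 3 := ((2 ^ k : ℕ) : ℤ) • e₀

/-- Truncated pair–pair correlation of the critical state on `ℤ³`:
`⟨σ_aσ_b ; σ_cσ_d⟩ := ⟨σ_aσ_bσ_cσ_d⟩_{β_c} − ⟨σ_aσ_b⟩_{β_c}⟨σ_cσ_d⟩_{β_c}` (`criticalCorr 3` = the
unique critical state; repetitions allowed, `σ² = 1`). With `(a,b) = (0,e₂)` and `(c,d) = (x, x+e₂)`
this is the left-hand side of `EnergyGapPowerLaw`. -/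
def pairTrunc (a b c d : Site 3) : ℝ :=
  criticalCorr 3 4 ![a, b, c, d] - criticalCorr 3 2 ![a, b] * criticalCorr 3 2 ![c, d]

/-! ## Stub A — reflection-positivity Cauchy–Schwarz with the energy row (the lever; size M) -/

/-- **A. `RPSchwarzOnePinch`** — the `2 × 2` Gram minor of reflection positivity across the mirror
`θ_t := axisRefl 0 t : y ↦ (t − y₀, y₁, y₂)` (the plane `y₀ = t/2`: a bond plane for odd `t`, a site
plane for even `t`), rows `ε_b − ⟨ε_b⟩` (`b = {0,e₂}`, in the half `2y₀ ≤ t`) and `σ_pσ_q − ⟨σ_pσ_q⟩`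
(`2p₀ ≤ t`, `2q₀ ≤ t`):
`⟨σ₀σ_{e₂} ; σ_{θp}σ_{θq}⟩² ≤ ⟨σ₀σ_{e₂} ; σ_{te₀}σ_{te₀+e₂}⟩ · ⟨σ_pσ_q ; σ_{θp}σ_{θq}⟩`
(`θ0 = te₀`, `θe₂ = te₀ + e₂`: the diagonal energy entry is GAP's pattern at `x = te₀`).
Proof route: finite-volume RP of the free-boundary n.n. Ising measure on `θ_t`-symmetric boxes
(`isingMeasure_univ_free_reflectionPositive` for even `t`, `…_of_cross` for odd `t`; or the torus
facts `isingTorus_reflectionPositive_sites/bonds_holds`) → `rp_cauchySchwarz_holds` with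
`F = ε_b − ⟨ε_b⟩`, `G = σ_pσ_q − ⟨σ_pσ_q⟩` (bounded, `positiveEvents`-measurable) → box limit to the
critical state (`criticalCorr_wellDefined_holds` along symmetric boxes, legitimate by
`hasUniqueGibbsMeasure_criticalBeta_holds`); reflection invariance turns `⟨F⟩⟨θG⟩` into the products
written here. FILS78 Thm 2.1; Friedli–Velenik Lemma 10.8; Biskup LNM 1970 Lemma 5.3. -/
def RPSchwarzOnePinch : Prop :=
  ∀ t : ℕ, 1 ≤ t → ∀ p q : Site 3, 2 * p 0 ≤ (t : ℤ) → 2 * q 0 ≤ (t : ℤ) →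
    pairTrunc 0 e₂ (axisRefl 0 (t : ℤ) p) (axisRefl 0 (t : ℤ) q) ^ 2 ≤
      pairTrunc 0 e₂ ((t : ℤ) • e₀) ((t : ℤ) • e₀ + e₂) *
        pairTrunc p q (axisRefl 0 (t : ℤ) p) (axisRefl 0 (t : ℤ) q)

/-- Registered stub A (statement = `RPSchwarzOnePinch`, by name; its text is the `def` above). -/
theorem stub_rpSchwarzOnePinch : RPSchwarzOnePinch := by
  sorry

/-! ## Stub B — GAP ⇒ the one-pinch law, all scales (RP halving; size S–M) -/

/-- **The one-pinch law** (output of halving, RP normalisation): for some `κ' > 0` (`= κ/2`) and `C`,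
for EVERY `t ≥ 1` and all pairs `p, q` in the plane `y₀ = 0`,
`⟨σ₀σ_{e₂} ; σ_{te₀+p}σ_{te₀+q}⟩ ≤ C t^{-κ'} G(te₀)²` — strands from the ADJACENT nails `0, e₂` to
targets on the far plane `y₀ = t`, one pinch only. -/
def OnePinchLaw : Prop :=
  ∃ κ C : ℝ, 0 < κ ∧ ∀ t : ℕ, 1 ≤ t → ∀ p q : Site 3, p 0 = 0 → q 0 = 0 →
    pairTrunc 0 e₂ ((t : ℤ) • e₀ + p) ((t : ℤ) • e₀ + q) ≤
      C * (t : ℝ) ^ (-κ) * criticalTwoPoint 3 ((t : ℤ) • e₀) ^ 2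

/-- **B. `GapGivesOnePinchLaw`**: the RP minor + GAP ⇒ the one-pinch law with exponent `κ/2`.
Proof route (all inputs in tree): for in-plane `p` the mirror image is `axisRefl 0 t p = te₀ + p`;
stub A at `(t, p, q)`; the energy entry is `EnergyGapPowerLaw` at `x = te₀ ≠ 0` (`‖te₀‖ = t`,
`criticalCorr_two` / `criticalCorr_two_pair` for `G`); the pair entry is
`≤ G(p, te₀+p)G(q, te₀+q) + G(p, te₀+q)G(q, te₀+p) ≤ 2G(te₀)²` by infinite-volume Lebowitz
`criticalUrsellFour_nonpos` and transverse Messager–Miracle-Solé `G((t,a,b)) ≤ G((t,0,0))`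
(`messager_miracleSole_holds` at `β_c`, `twoPointPlus_le_single_of_nonneg` after sign reflections
`twoPointPlus_single_eq_single` / reflection invariance; `criticalTwoPoint = twoPointPlus _ (criticalBeta _)`
by `rfl`); nonnegativity of the energy entry (GKS II through `criticalCorr_wellDefined_holds` box
limits, or `criticalCorr_griffiths` of the Disproof) and `Real.sqrt` monotonicity give
`X ≤ √(max C 0 · 2) · t^{-κ/2} G(te₀)²`. Exponent check: 2D `κ = 3/2 ↦ 3/4 = Δ_ε − 2Δ_σ`; ℤ³
`0.753 ↦ 0.376`. -/
def GapGivesOnePinchLaw : Prop := RPSchwarzOnePinch → EnergyGapPowerLaw → OnePinchLaw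

/-- Registered stub B (statement = `GapGivesOnePinchLaw`, unfolded one level). -/
theorem stub_gapGivesOnePinchLaw : RPSchwarzOnePinch → EnergyGapPowerLaw → OnePinchLaw := by
  sorry

/-! ## Stub R — the avoidance-ready reading on regular dyadic scales (size S–M) -/

/-- **The one-pinch law on regular scales** (cross-Wick / Aizenman normalisation): `κ' > 0`, `C`,
`c₀ > 0` such that (i) `c₀`-doubling-regular dyadic scales `k` (`c₀ G(2^k e₀) ≤ G(2^{k+2} e₀)`) are
UNBOUNDED, and (ii) at every such scale, for all in-plane targets in the cone `‖p‖, ‖q‖ ≤ 2^k`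
(sup norm), with `T = 2^k e₀`,
`⟨σ₀σ_{e₂} ; σ_{T+p}σ_{T+q}⟩ ≤ C (2^k)^{-κ'} (⟨σ₀σ_{T+p}⟩⟨σ_{e₂}σ_{T+q}⟩ + ⟨σ₀σ_{T+q}⟩⟨σ_{e₂}σ_{T+p}⟩)`.
By `EnergyFactorisation` (item 4472; infinite volume) the right-hand bracket splits the left-hand
side as `GG·A_par + GG·A_cross`, so (ii) says: BOTH single-pinch avoidance probabilities of two
independent sourced critical currents `0 → T+p`, `e₂ → T+q` are `≤ C (2^k)^{-κ'}` — the
probabilistic form the transfer consumes. -/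
def OnePinchLawOnRegularScales : Prop :=
  ∃ κ C c₀ : ℝ, 0 < κ ∧ 0 < c₀ ∧
    (∀ k₀ : ℕ, ∃ k : ℕ, k₀ ≤ k ∧
      c₀ * criticalTwoPoint 3 (dy k) ≤ criticalTwoPoint 3 (dy (k + 2))) ∧
    ∀ k : ℕ, c₀ * criticalTwoPoint 3 (dy k) ≤ criticalTwoPoint 3 (dy (k + 2)) →
      ∀ p q : Site 3, p 0 = 0 → q 0 = 0 → ‖p‖ ≤ ((2 ^ k : ℕ) : ℝ) → ‖q‖ ≤ ((2 ^ k : ℕ) : ℝ) →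
        pairTrunc 0 e₂ (dy k + p) (dy k + q) ≤
          C * ((2 ^ k : ℕ) : ℝ) ^ (-κ) *
            (criticalCorr 3 2 ![0, dy k + p] * criticalCorr 3 2 ![e₂, dy k + q] +
              criticalCorr 3 2 ![0, dy k + q] * criticalCorr 3 2 ![e₂, dy k + p])

/-- **R. `RegularReading`**: the one-pinch law (all `t`, RP normalisation) implies its regular-scale,
cross-Wick-normalised form. Proof route (all inputs in tree): (i) abundance — if
`c₀ G(2^k e₀) ≤ G(2^{k+2} e₀)` failed for all `k ≥ k₀` with `c₀ = 1/32`, then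
`G(2^{k₀+2i} e₀) < 32^{-i}` against the Simon–Lieb lower bound `c (2^{k₀+2i})^{-2} ≤ G`
(`criticalTwoPoint_bounds_holds`, `criticalTwoPoint_le_one'`), absurd for large `i`; (ii) at a
regular `k`, `t = 2^k`, for `‖p‖ ≤ t`: `G(0, T+p) = G((t,p₁,p₂)) ≥ G((t+|p₁|+|p₂|) e₀) ≥ G(3t e₀)
≥ G(4t e₀) ≥ c₀ G(t e₀)` and `G(e₂, T+q) = G((t, q₁−1, q₂)) ≥ G((3t+1) e₀) ≥ G(4t e₀) ≥ c₀ G(te₀)`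
(`twoPointPlus_single_sum_le` = diagonal MMS `messager_miracleSole_diag_holds`, axis MMS
`twoPointPlus_add_single_le`, sign reflections; `criticalCorr_two_pair`), so the cross-Wick bracket is
`≥ 2c₀² G(te₀)²` and `C ↦ max C 0 / (2c₀²)`. ADC21 Def 5.11 regularity (`IsRegularScale`, tree) is
NOT needed here; only doubling along the axis. -/
def RegularReading : Prop := OnePinchLaw → OnePinchLawOnRegularScales

/-- Registered stub R (statement = `RegularReading`, unfolded one level). -/
theorem stub_regularReading : OnePinchLaw → OnePinchLawOnRegularScales := by
  sorry

/-! ## Stub T — the transfer `C⁺` (hardest; open): one pinch on regular scales ⇒ split-pinch far merging -/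

/-- The THIN split-pinch shapes `X_m := (0, 2^m e₀ − 2^m e₂, e₂, 2^m e₀ + 2^m e₂)`, labelled
(source₁, target₁, source₂, target₂): dilated by `L = 2^j` the sources `0, Le₂` are `L` apart, the
targets `(2^m L, ∓2^m L, 0)` sit on the far plane at distance `t = 2^m L`, and the `(x₀x₁)(x₂x₃)`
pairing product of `FarMerging` is `G(0, LY)·G(Le₂, LZ)`, Aizenman's normalisation of the merging
probability of the PARALLEL strands `0 → (t,−t,0)`, `Le₂ → (t,t,0)`. -/
def thinShape (m : ℕ) : Fin 4 → Site 3 :=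
  ![0, dy m - ((2 ^ m : ℕ) : ℤ) • e₂, e₂, dy m + ((2 ^ m : ℕ) : ℤ) • e₂]

/-- **Dyadic split-pinch far merging** (T's conclusion): `c > 0` and a FINITE shape menu `m ≤ M`
such that for unboundedly many dyadic dilations `L = 2^j` some `X_m` of the menu has
`U₄(L X_m) ≤ −c ⟨σ_{Lx₀}σ_{Lx₁}⟩⟨σ_{Lx₂}σ_{Lx₃}⟩` — verbatim the inequality of the crux's consequent
(`FarMergingShape cc2 (criticalCorr 3 4)`) at `x = X_m`, `L = 2^j`; by Aizenman's identity
(gen-1 Disproof §5 `U4_criticalCorr_eq`) it says `P^{0,LY}⊗P^{Le₂,LZ}[0 ↔ Le₂] ≥ c/2`. -/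
def DyadicSplitMerging : Prop :=
  ∃ c : ℝ, 0 < c ∧ ∃ M : ℕ, ∀ j₀ : ℕ, ∃ j : ℕ, j₀ ≤ j ∧ ∃ m : ℕ, m ≤ M ∧
    criticalCorr 3 4 (fun i => ((2 ^ j : ℕ) : ℤ) • thinShape m i) -
        (criticalCorr 3 2 ![((2 ^ j : ℕ) : ℤ) • thinShape m 0, ((2 ^ j : ℕ) : ℤ) • thinShape m 1] *
            criticalCorr 3 2 ![((2 ^ j : ℕ) : ℤ) • thinShape m 2, ((2 ^ j : ℕ) : ℤ) • thinShape m 3] +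
          criticalCorr 3 2 ![((2 ^ j : ℕ) : ℤ) • thinShape m 0, ((2 ^ j : ℕ) : ℤ) • thinShape m 2] *
            criticalCorr 3 2 ![((2 ^ j : ℕ) : ℤ) • thinShape m 1, ((2 ^ j : ℕ) : ℤ) • thinShape m 3] +
          criticalCorr 3 2 ![((2 ^ j : ℕ) : ℤ) • thinShape m 0, ((2 ^ j : ℕ) : ℤ) • thinShape m 3] *
            criticalCorr 3 2 ![((2 ^ j : ℕ) : ℤ) • thinShape m 1, ((2 ^ j : ℕ) : ℤ) • thinShape m 2])
      ≤ -(c * (criticalCorr 3 2 ![((2 ^ j : ℕ) : ℤ) • thinShape m 0, ((2 ^ j : ℕ) : ℤ) • thinShape m 1] *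
            criticalCorr 3 2 ![((2 ^ j : ℕ) : ℤ) • thinShape m 2, ((2 ^ j : ℕ) : ℤ) • thinShape m 3]))

/-- **T. `OnePinchForcesSplitMerging`** — the TRANSFER (`C⁺` of the card; the open, model-specific
step, cf. `oneEndedGapForcesFarMerging_false_without_model`): the one-pinch power law (all scales, RP
normalisation, and its avoidance-ready form on unboundedly many regular dyadic scales) forces
split-pinch far merging along a thin shape of a finite menu.
Intended proof (sourced random currents on `ℤ³`; see the line card): (1) dictionary — by
`EnergyFactorisation` in infinite volume the hypothesis reads `P^{0Y}⊗P^{e₂Z}[0 ↮ e₂] ≤ C t^{-κ'}`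
at regular `t = 2^k`, targets `Y, Z = (t, ∓t, 0)`; (2) hazard telescoping at the remaining pinch —
`P[avoid] = ∏_{j ≤ k} (1 − h_j)`, `h_j` = conditional probability of a first meeting in
`B_{2^{j+1}} ∖ B_{2^j}` given none in `B_{2^j}`, so `Σ_j −log(1 − h_j) ≥ κ' k log 2 − C` and some
`h_{j(k)} ≥ 1 − 2^{-κ'/2}` (the i.o. form of Disproof §7; no density needed); (3) EndpointLocality
(Disproof §7 (H), the crux of the crux): Harnack comparability in ONE endpoint for sourced-current
probabilities of events at scale `2^j` under displacements of the far targets (`≥ 16·2^j` away) and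
of the near source within `B_{2^j}` — pins `m = k − j ≤ M` and converts the conditional hazard into
unconditional merging `≥ c` of the `2^j`-split pair; (4) Aizenman's identity `U₄ = −2GG·P[merge]`
(`ursellFour_eq_doubleCurrent_holds` / gen-1 `U4_criticalCorr_eq`) back to correlators on the exact
dyadic dilation `2^j • X_m`. Why it might fail: (3) is ratio-mixing strength for SOURCED currents on
`ℤ³` (ADC21 §6 is `d = 4`, sourceless; Panis arXiv:2406.15243 Thm 2.4 is sourced but additive and
non-quantitative in `d = 3`). -/
def OnePinchForcesSplitMerging : Prop :=
  OnePinchLaw → OnePinchLawOnRegularScales → DyadicSplitMerging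

/-- Registered stub T (statement = `OnePinchForcesSplitMerging`, unfolded one level): the transfer
may use BOTH forms of the one-pinch law — all scales in RP normalisation (`OnePinchLaw`) and the
avoidance-ready form on unboundedly many regular dyadic scales (`OnePinchLawOnRegularScales`). -/
theorem stub_onePinchForcesSplitMerging :
    OnePinchLaw → OnePinchLawOnRegularScales → DyadicSplitMerging := by
  sorry

/-! ## The composition (proved): A → B → R → T → crux -/

/-- Infinite pigeonhole over a finite menu: if for unboundedly many `j` some index `m ≤ M` works,
then one fixed `m ≤ M` works for unboundedly many `j`. -/
theorem exists_index_io {M : ℕ} {P : ℕ → ℕ → Prop}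
    (h : ∀ j₀ : ℕ, ∃ j : ℕ, j₀ ≤ j ∧ ∃ m : ℕ, m ≤ M ∧ P m j) :
    ∃ m : ℕ, m ≤ M ∧ ∀ j₀ : ℕ, ∃ j : ℕ, j₀ ≤ j ∧ P m j := by
  induction M with
  | zero =>
    refine ⟨0, le_rfl, fun j₀ => ?_⟩
    obtain ⟨j, hj, m, hm, hP⟩ := h j₀
    obtain rfl : m = 0 := Nat.le_zero.mp hm
    exact ⟨j, hj, hP⟩
  | succ M ih =>
    by_cases htop : ∀ j₀ : ℕ, ∃ j : ℕ, j₀ ≤ j ∧ P (M + 1) j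
    · exact ⟨M + 1, le_rfl, htop⟩
    · push Not at htop
      obtain ⟨j₁, hj₁⟩ := htop
      have h' : ∀ j₀ : ℕ, ∃ j : ℕ, j₀ ≤ j ∧ ∃ m : ℕ, m ≤ M ∧ P m j := by
        intro j₀
        obtain ⟨j, hj, m, hm, hP⟩ := h (max j₀ j₁)
        have hne : m ≠ M + 1 := by
          rintro rfl
          exact hj₁ j (le_trans (le_max_right _ _) hj) hP
        exact ⟨j, le_trans (le_max_left _ _) hj, m, by omega, hP⟩
      obtain ⟨m, hm, hio⟩ := ih h'
      exact ⟨m, by omega, hio⟩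

/-- A quadruple with pairwise distinct entries is injective. -/
theorem injective_vec4 {α : Type*} {a b c d : α} (hab : a ≠ b) (hac : a ≠ c) (had : a ≠ d)
    (hbc : b ≠ c) (hbd : b ≠ d) (hcd : c ≠ d) : Function.Injective ![a, b, c, d] := by
  intro i j h
  fin_cases i <;> fin_cases j <;> simp at h ⊢
  all_goals first
    | exact absurd h hab
    | exact absurd h.symm hab
    | exact absurd h hac
    | exact absurd h.symm hac
    | exact absurd h had
    | exact absurd h.symm had
    | exact absurd h hbc
    | exact absurd h.symm hbc
    | exact absurd h hbd
    | exact absurd h.symm hbd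
    | exact absurd h hcd
    | exact absurd h.symm hcd

/-- The thin shapes are injective (all four lattice points distinct). -/
theorem thinShape_injective (m : ℕ) : Function.Injective (thinShape m) := by
  have h2 : (0 : ℤ) < 2 ^ m := by positivity
  unfold thinShape
  refine injective_vec4 ?_ ?_ ?_ ?_ ?_ ?_
  · intro h; have := congrFun h 0; simp at this; linarith   -- `0 ≠ 2^m e₀ − 2^m e₂` (coordinate 0)
  · intro h; have := congrFun h 1; simp at this             -- `0 ≠ e₂` (coordinate 1)
  · intro h; have := congrFun h 0; simp at this; linarith   -- `0 ≠ 2^m e₀ + 2^m e₂` (coordinate 0)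
  · intro h; have := congrFun h 0; simp at this             -- `2^m e₀ − 2^m e₂ ≠ e₂` (coordinate 0)
  · intro h; have := congrFun h 1; simp at this; linarith   -- the two targets differ (coordinate 1)
  · intro h; have := congrFun h 0; simp at this; linarith   -- `e₂ ≠ 2^m e₀ + 2^m e₂` (coordinate 0)

/-- `DyadicSplitMerging` is a far-merging witness: fix the shape by pigeonhole over the finite menu
and dilate dyadically (`L = 2^j ≥ j ≥ L₀`). -/
theorem farMergingShape_of_dyadicSplitMerging (h : DyadicSplitMerging) :
    Negative.FarMergingShape Negative.cc2 (criticalCorr 3 4) := by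
  obtain ⟨c, hc, M, hio⟩ := h
  obtain ⟨m, -, hm⟩ := exists_index_io hio
  refine ⟨c, hc, thinShape m, thinShape_injective m, fun L₀ => ?_⟩
  obtain ⟨j, hj, hP⟩ := hm L₀
  exact ⟨2 ^ j, le_trans hj (Nat.lt_two_pow_self).le, hP⟩

/-! ### Registered-stub aliases
`Registered.stub_X` is stub `X`'s statement under the registered stub's short name, so that the native
skeleton audit (`#h21_check_skeleton … stub_…`) accepts the hypotheses of `GapForcesFarMerging_of` as the
registered obligations (hypothesis heads are matched by name). -/
namespace Registered

/-- Statement of registered stub A. -/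
abbrev stub_rpSchwarzOnePinch : Prop := RPSchwarzOnePinch
/-- Statement of registered stub B. -/
abbrev stub_gapGivesOnePinchLaw : Prop := GapGivesOnePinchLaw
/-- Statement of registered stub R. -/
abbrev stub_regularReading : Prop := RegularReading
/-- Statement of registered stub T. -/
abbrev stub_onePinchForcesSplitMerging : Prop := OnePinchForcesSplitMerging

end Registered

/-- **The skeleton closes the crux modulo the registered stubs**: feed GAP to B (with A), read it
on regular scales (R), transfer (T), fix the shape (pigeonhole) — `GapForcesFarMerging` BY NAME. -/
theorem GapForcesFarMerging_of (hA : Registered.stub_rpSchwarzOnePinch)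
    (hB : Registered.stub_gapGivesOnePinchLaw) (hR : Registered.stub_regularReading)
    (hT : Registered.stub_onePinchForcesSplitMerging) : GapForcesFarMerging :=
  Negative.crux_iff.2 fun hgap =>
    have hO : OnePinchLaw := hB hA hgap
    farMergingShape_of_dyadicSplitMerging (hT hO (hR hO))

/-- How the closed proof is obtained once the four stubs land (kept as an `example` so that
`GapForcesFarMerging_of` is the only theorem of this file concluding the crux). -/
example : GapForcesFarMerging :=
  GapForcesFarMerging_of stub_rpSchwarzOnePinch stub_gapGivesOnePinchLaw stub_regularReading
    stub_onePinchForcesSplitMerging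

end Summit.CriticalPhenomena.Ising3DConformalLimit.Cruxes.GapForcesFarMerging.RPSchwarzSinglePinch

end
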